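import Literature.AlgebraicGeometry.AbelianSchemes.AbelianSchemeDualTransport
import Literature.AlgebraicGeometry.AbelianSchemes.AbelianSchemePolarization
import HarnessLib

/-!
# The dual transport and the `𝒫`-slices: the transported polarisation `λ' := e ≫ λ ≫ Ĥ_e⁻¹` and its slices
# (the scheme-level half of the `IsLambdaOfAt` transport along `(e, Ĥ_e)`; sequel of ★ `AbelianSchemeDualTransport`)

Topic `AlgebraicGeometry/AbelianSchemes`; namespace `Literature.AlgebraicGeometry.AbelianSchemes.AbelianSchemeOver.DualPair`.
Cell hodgecm-mathlib (D-0151), rung-0 ladder / M1PRIME-DAG **W3c (c-ii-T)**, over ★ `AbelianSchemeDualTransport`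
(`fibreIsoOfIso`, `hatTransport`, `hatTransportOver`, `nonempty_pullback_map_hatTransport_iso`,
`hatTransport_comp_hatTransport`) and ★ D2p2 `AbelianSchemePolarization` (`valueAt`, `sliceAt`, `IsLambdaOfAt`).  One
definition with body (`lamTransport`, the transported `S`-morphism `A' → Â'`) + THEOREMS; no structure, no named fact, no
instance, no `sorry`; books 0.  HC_CM is proved only modulo the printed citations until rung 0 closes.

## What is proved ([MumfordFogartyKirwan1994] Def. 6.2/6.3 read through an isomorphism of triples, Def. 7.3 along `𝟙`)
* `lamTransport D D' e e' lam : A'.X ⟶ D'.hat.X` := `e ≫ λ ≫ Ĥ_{e'}` (`Ĥ_{e'} = Ĥ_e⁻¹`), `lamTransport_left`;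
* `fibrePointToLeft_map_fibreIsoOfIso` — the point of `A` under `e_s(P')` is the point of `A'` under `P'` followed by `e`;
* `valueAt_lamTransport` — **`λ̄'(P') = Ĥ_{e'}(λ̄(e_s P'))`**;
* `sliceAt_lamTransport_comp_map` — the slice of `A' × Â'` at `λ̄'(P')` followed by `e × Ĥ_e` is `e_s` followed by the
  slice of `A × Â` at `λ̄(e_s P')` (uses `Ĥ_{e'} ≫ Ĥ_e = 𝟙`);
* **`nonempty_pullback_sliceAt_lamTransport_iso`** — `𝒫'|_{A'_s × {λ̄'(P')}} ≅ e_s^*(𝒫|_{A_s × {λ̄(e_s P')}})` (Poincaré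
  clause of ★ `AbelianSchemeDualTransport`), and with `IsLambdaOfAt s D λ Θ`:
  **`nonempty_pullback_sliceAt_lamTransport_iso_of_isLambdaOfAt`** — `𝒫'|_{A'_s × {λ̄'(P')}} ≅ e_s^*(t_{e_s P'}^*𝒪(Θ) ⊗ 𝒪(Θ)⁻¹)`.
  (What remains for `IsLambdaOfAt s D' λ' (e_s^*Θ)` is module algebra on `A'_s`: `e_s^*` commutes with `⊗`, `(·)^∨`,
  `t_{e_s P'} ∘ e_s = e_s ∘ t_{P'}` and `e_s^*𝒪(Θ) = 𝒪(e_s^*Θ)` — not in this file.)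

## References
* [MumfordFogartyKirwan1994] D. Mumford, J. Fogarty, F. Kirwan, *Geometric Invariant Theory*, 3rd ed. (1994), Ch. 6 §2
  Definitions 6.2–6.3 (p. 120), Ch. 7 §2 Definition 7.3 (p. 130).
* [MilneAV2008] J. S. Milne, *Abelian Varieties* (v2.00, 2008), I §8 pp. 36–37.
-/

set_option autoImplicit false

universe u

open CategoryTheory CategoryTheory.Limits AlgebraicGeometry MonoidalCategory

noncomputable section

namespace Literature.AlgebraicGeometry.AbelianSchemes

namespace AbelianSchemeOver

open Literature.AlgebraicGeometry.Motives Literature.AlgebraicGeometry.Modules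
open Literature.AlgebraicGeometry.AbelianVarieties
open scoped MonObj

variable {S : Scheme.{u}} {A A' : AbelianSchemeOver S}

namespace DualPair

variable (D : A.DualPair) (D' : A'.DualPair) (e : A'.X ≅ A.X) [IsMonHom e.hom] (e' : A.X ≅ A'.X) [IsMonHom e'.hom]
  (lam : A.X ⟶ D.hat.X)

/-- **The transported `S`-morphism `λ' := e ≫ λ ≫ Ĥ_{e'} : A' → Â'`** (with `Ĥ_{e'} = Ĥ_e⁻¹` when `e' = e⁻¹`; a
homomorphism when `λ` is, by composition; non-Prop plumbing). [cite: MumfordFogartyKirwan1994, Ch. 7 §2 Definition 7.3 (p. 130)] -/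
def lamTransport : A'.X ⟶ D'.hat.X :=
  e.hom ≫ lam ≫ hatTransportOver D' D e'

omit [IsMonHom e.hom] in
/-- Underlying scheme morphism of `λ'`. [cite: MumfordFogartyKirwan1994, Ch. 7 §2 Definition 7.3 (p. 130)] -/
theorem lamTransport_left : (lamTransport D D' e e' lam).left = e.hom.left ≫ lam.left ≫ hatTransport D' D e' := rfl

variable {Ω : Type u} [Field Ω] (s : Spec (.of Ω) ⟶ S)

/-- The point of `A` under `e_s(P')` is the point of `A'` under `P'` followed by `e`. [cite: MumfordFogartyKirwan1994, Ch. 6 §1 Definition 6.1 (p. 115)] -/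
theorem fibrePointToLeft_map_fibreIsoOfIso (P' : (A'.fibre s).toAbelianVariety.Points Ω) :
    A.fibrePointToLeft s (AlgPoints.map (fibreIsoOfIso e s).hom.hom.hom.hom P') =
      A'.fibrePointToLeft s P' ≫ e.hom.left := by
  change (P' ≫ (fibreIsoOfIso e s).hom.hom.hom.hom).left ≫ pullback.fst A.X.hom s = _
  rw [Over.comp_left, Category.assoc]
  exact (congrArg (fun x => P'.left ≫ x) (fibreIsoOfIso_hom_toSchemeHom_fst e s)).trans (Category.assoc _ _ _).symm

/-- **`λ̄'(P') = Ĥ_{e'}(λ̄(e_s P'))`**. [cite: MumfordFogartyKirwan1994, Ch. 6 §2 Definition 6.3 (p. 120)] -/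
theorem valueAt_lamTransport (P' : (A'.fibre s).toAbelianVariety.Points Ω) :
    A'.valueAt s D' (lamTransport D D' e e' lam) P' =
      A.valueAt s D lam (AlgPoints.map (fibreIsoOfIso e s).hom.hom.hom.hom P') ≫ hatTransport D' D e' := by
  change A'.fibrePointToLeft s P' ≫ (lamTransport D D' e e' lam).left =
    (A.fibrePointToLeft s _ ≫ lam.left) ≫ hatTransport D' D e'
  rw [lamTransport_left, fibrePointToLeft_map_fibreIsoOfIso]
  simp only [Category.assoc]

/-- **The slice square**: `(A'_s × {λ̄'(P')}) ≫ (e × Ĥ_e) = e_s ≫ (A_s × {λ̄(e_s P')})` when `e' = e⁻¹`.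
[cite: MumfordFogartyKirwan1994, Ch. 6 §2 Definition 6.2 (p. 120) and Ch. 7 §2 Definition 7.3 (p. 130)] -/
theorem sliceAt_lamTransport_comp_map (he' : e'.hom = e.inv) (P' : (A'.fibre s).toAbelianVariety.Points Ω) :
    A'.sliceAt s D' (lamTransport D D' e e' lam) P' ≫
        pullback.map A'.X.hom D'.hat.X.hom A.X.hom D.hat.X.hom e.hom.left (hatTransport D D' e) (𝟙 S)
          (by rw [Category.comp_id, Over.w e.hom]) (by rw [Category.comp_id, hatTransport_comp_hom]) =
      AbelianVariety.Hom.toSchemeHom (fibreIsoOfIso e s).hom ≫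
        A.sliceAt s D lam (AlgPoints.map (fibreIsoOfIso e s).hom.hom.hom.hom P') := by
  have hinv : hatTransport D' D e' ≫ hatTransport D D' e = 𝟙 _ := hatTransport_comp_hatTransport D D' e e' he'
  have hv : A'.valueAt s D' (lamTransport D D' e e' lam) P' ≫ hatTransport D D' e =
      A.valueAt s D lam (AlgPoints.map (fibreIsoOfIso e s).hom.hom.hom.hom P') := by
    rw [valueAt_lamTransport, Category.assoc, hinv, Category.comp_id]
  apply pullback.hom_ext
  · have L0 : (A'.sliceAt s D' (lamTransport D D' e e' lam) P' ≫
          pullback.map A'.X.hom D'.hat.X.hom A.X.hom D.hat.X.hom e.hom.left (hatTransport D D' e) (𝟙 S)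
            (by rw [Category.comp_id, Over.w e.hom]) (by rw [Category.comp_id, hatTransport_comp_hom])) ≫
          pullback.fst A.X.hom D.hat.X.hom = pullback.fst A'.X.hom s ≫ e.hom.left :=
      (Category.assoc _ _ _).trans
        ((congrArg (fun x => A'.sliceAt s D' (lamTransport D D' e e' lam) P' ≫ x) (pullback.lift_fst _ _ _)).trans
          ((Category.assoc _ _ _).symm.trans
            (congrArg (fun x => x ≫ e.hom.left) (A'.sliceAt_fst s D' _ P'))))
    have R0 : (AbelianVariety.Hom.toSchemeHom (fibreIsoOfIso e s).hom ≫
          A.sliceAt s D lam (AlgPoints.map (fibreIsoOfIso e s).hom.hom.hom.hom P')) ≫ pullback.fst A.X.hom D.hat.X.hom =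
        pullback.fst A'.X.hom s ≫ e.hom.left :=
      (Category.assoc _ _ _).trans
        ((congrArg (fun x => AbelianVariety.Hom.toSchemeHom (fibreIsoOfIso e s).hom ≫ x) (A.sliceAt_fst s D lam _)).trans
          (fibreIsoOfIso_hom_toSchemeHom_fst e s))
    exact L0.trans R0.symm
  · have L1 : (A'.sliceAt s D' (lamTransport D D' e e' lam) P' ≫
          pullback.map A'.X.hom D'.hat.X.hom A.X.hom D.hat.X.hom e.hom.left (hatTransport D D' e) (𝟙 S)
            (by rw [Category.comp_id, Over.w e.hom]) (by rw [Category.comp_id, hatTransport_comp_hom])) ≫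
          pullback.snd A.X.hom D.hat.X.hom =
        pullback.snd A'.X.hom s ≫ A.valueAt s D lam (AlgPoints.map (fibreIsoOfIso e s).hom.hom.hom.hom P') :=
      (Category.assoc _ _ _).trans
        ((congrArg (fun x => A'.sliceAt s D' (lamTransport D D' e e' lam) P' ≫ x) (pullback.lift_snd _ _ _)).trans
          ((Category.assoc _ _ _).symm.trans
            ((congrArg (fun x => x ≫ hatTransport D D' e) (A'.sliceAt_snd s D' _ P')).trans
              ((Category.assoc _ _ _).trans
                (congrArg (fun x => pullback.snd A'.X.hom s ≫ x) hv)))))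
    have R1 : (AbelianVariety.Hom.toSchemeHom (fibreIsoOfIso e s).hom ≫
          A.sliceAt s D lam (AlgPoints.map (fibreIsoOfIso e s).hom.hom.hom.hom P')) ≫ pullback.snd A.X.hom D.hat.X.hom =
        pullback.snd A'.X.hom s ≫ A.valueAt s D lam (AlgPoints.map (fibreIsoOfIso e s).hom.hom.hom.hom P') :=
      (Category.assoc _ _ _).trans
        ((congrArg (fun x => AbelianVariety.Hom.toSchemeHom (fibreIsoOfIso e s).hom ≫ x) (A.sliceAt_snd s D lam _)).trans
          ((Category.assoc _ _ _).symm.trans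
            (congrArg (fun x => x ≫ A.valueAt s D lam _) (fibreIsoOfIso_hom_toSchemeHom_snd e s))))
    exact L1.trans R1.symm

/-- **`𝒫'|_{A'_s × {λ̄'(P')}} ≅ e_s^*(𝒫|_{A_s × {λ̄(e_s P')}})`** — the Poincaré clause `(e × Ĥ_e)^*𝒫 ≅ 𝒫'` restricted
along the slice square. [cite: MumfordFogartyKirwan1994, Ch. 7 §2 Definition 7.3 (p. 130)] [cite: MilneAV2008, I §8 pp. 36–37] -/
theorem nonempty_pullback_sliceAt_lamTransport_iso (he' : e'.hom = e.inv) (P' : (A'.fibre s).toAbelianVariety.Points Ω) :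
    Nonempty ((Scheme.Modules.pullback (A'.sliceAt s D' (lamTransport D D' e e' lam) P')).obj D'.P ≅
      (Scheme.Modules.pullback (AbelianVariety.Hom.toSchemeHom (fibreIsoOfIso e s).hom)).obj
        ((Scheme.Modules.pullback (A.sliceAt s D lam (AlgPoints.map (fibreIsoOfIso e s).hom.hom.hom.hom P'))).obj D.P)) := by
  obtain ⟨i⟩ := nonempty_pullback_map_hatTransport_iso D D' e
  exact ⟨(Scheme.Modules.pullback _).mapIso i.symm ≪≫ (Scheme.Modules.pullbackComp _ _).app D.P ≪≫
    (Scheme.Modules.pullbackCongr (sliceAt_lamTransport_comp_map D D' e e' lam s he' P')).app D.P ≪≫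
    ((Scheme.Modules.pullbackComp _ _).app D.P).symm⟩

/-- **With `λ̄ = Λ(𝒪(Θ))` on the `A`-side**: `𝒫'|_{A'_s × {λ̄'(P')}} ≅ e_s^*(t_{e_s P'}^*𝒪(Θ) ⊗ 𝒪(Θ)⁻¹)` — the
`IsLambdaOfAt` transport along `(e, Ĥ_e)` up to module algebra on `A'_s`. [cite: MumfordFogartyKirwan1994, Ch. 6 §2 Definition 6.2 (p. 120)] -/
theorem nonempty_pullback_sliceAt_lamTransport_iso_of_isLambdaOfAt (he' : e'.hom = e.inv)
    {Θ : CartierDivisor (A.fibre s).toAbelianVariety.X.left} (h : A.IsLambdaOfAt s D lam Θ)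
    (P' : (A'.fibre s).toAbelianVariety.Points Ω) :
    Nonempty ((Scheme.Modules.pullback (A'.sliceAt s D' (lamTransport D D' e e' lam) P')).obj D'.P ≅
      (Scheme.Modules.pullback (AbelianVariety.Hom.toSchemeHom (fibreIsoOfIso e s).hom)).obj
        (tensorObj
          ((Scheme.Modules.pullback ((A.fibre s).toAbelianVariety.translation
              (AlgPoints.map (fibreIsoOfIso e s).hom.hom.hom.hom P')).left).obj (A.lineBundleOfDivisor s Θ))
          (Modules.dual (A.lineBundleOfDivisor s Θ)))) := by
  obtain ⟨i⟩ := nonempty_pullback_sliceAt_lamTransport_iso D D' e e' lam s he' P'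
  obtain ⟨j⟩ := h (AlgPoints.map (fibreIsoOfIso e s).hom.hom.hom.hom P')
  exact ⟨i ≪≫ (Scheme.Modules.pullback _).mapIso j⟩

end DualPair

end AbelianSchemeOver

end Literature.AlgebraicGeometry.AbelianSchemes

end
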